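import Literature.NumberTheory.GaloisRepresentations.SUnitsRestrictedLayersRelative
import Literature.NumberTheory.GaloisRepresentations.SUnitsCoinducedLayerPresentation
import Literature.NumberTheory.GaloisRepresentations.ContinuousShapiroOpenCoinducedShapiroExt
import Literature.NumberTheory.GaloisRepresentations.SUnitsRestrictedLayersTransitions
import Literature.NumberTheory.GaloisCohomology.TateEulerCharacteristicPrimeToPBaseInputs
import HarnessLib

/-!
# THE LAYER PRESENTATION of `𝓗²(E_S) = H²(U, Maps(U⧸W, E_S))` by the `S`-unit layers `H²(Gal(E′/E), 𝒪_{E′,S}ˣ)`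
# (NSW VIII §3, (1.5.1), I §6 (1.6.4)–(1.6.5); Serre, *Cohomologie galoisienne* I §2.2 Prop. 8, §2.5 Prop. 10)

Topic `NumberTheory/GaloisRepresentations`; namespace `Literature.NumberTheory.GaloisRepresentations.SUnits.Layers`.
Definitions with bodies (the layer maps and THE INSTANCE `layerPresentation` of -w3 g16's hypothesis structure
`LayerPresentation` of `SUnitsCoinducedLayerPresentation`) and theorems; NO named fact, no `sorry`, no instance, no
notation.  Lane «TATE-EPC-TC» of cell `bsd-eis` (crux `GoodLatticeBDPValue`, stmt-BirchSwinnertonDyer-19032), piece G1 file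
3 of 3: the last input of FILE D (`hH2`).

CONSTRUCTION (all ingredients are tree theorems).  `W := layerW hHo E hF hS = Gal(K_S/E) ≤ U`, `ρ := resRep K S H`,
`M_W := stdBase (resTop W ρ.toTopRep) _` (`E_S|_W` in door-c4's `C_W`, -w2 g9's spelling; = `(resD ℤ W).obj (resD K S H hHo)` of G1 file 2 by `rfl`, bridged in §2 by one-line `exact` lemmas), `𝓗² := coindH2 hHo E hF hS`.
* `toCoindW := sh⁻¹ ∘ Φ_W : Ext²_{C_W}(ℤ, M_W) →+ 𝓗²` — door-c4's comparison `Φ_W = extTrivAddEquivContinuousCohomology` for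
  `W` followed by the inverse of -w7 g9's continuous Shapiro isomorphism `sh = ρ.shapiroOpenAddEquiv W`; injective.
* **(a)** `layerToCoind E′ := toCoindW ∘ Inf^W_{V′∩W} ∘ (J′_{E′})⁻¹` with door-c4's `inflG` and G1 file 2's
  `J′ = traceLayerCohomologyIso : H²(↥W ⧸ (V′ ∩ W), (E_S|_W)^{V′∩W}) ≅ H²(Gal(E′/E), 𝒪_{E′,S}ˣ)`.
* **(b)** `layerToCoind_layerInf`: `inflG_stepG` + file 2's `traceLayerCohomologyIso_hom_stepG` (transitions = `layerInf`).
* **(c)** `exists_layerToCoind_eq`: door-c4's `exists_inflG_eq` for `↥W` + file 1's cofinality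
  `exists_layer_traceOpenNormalSubgroup_le`.
* **(d)** `exists_layerInf_eq_zero_of_layerToCoind_eq_zero`: `toCoindW` injective + door-c4's `exists_stepG_eq_zero` +
  cofinality + `stepG_stepG`.
* **(e)** `coindOpenHRep_layerToCoind`: -w2 g9's dictionary (`shapiroOpenAddEquiv_extTriv_inflG`: `sh` reads a `U`-layer
  representative `y` as `Hⁿ(κ, λ)(shapiroFun y)`; `coindOpenHRep_layer_conj`: the right translation `R_d` acts on `y` by
  `Hⁿ(rTrans)` and is read by `shapiroFun` as `conjRepCohomology`) + file 2's `traceLayerCohomologyIso_hom_map_traceQuotMapRange`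
  (`J′ ∘ Hⁿ(κ, λ′) = J`) and `relLayerCohomologyIso_hom_conjRepCohomology` (`J ∘ conjRepCohomology g = σ_{layerEquiv E′ g} ∘ J`).
* `layerPresentation hHo hNH hF hS : LayerPresentation hHo E hF hS` — -w3's structure, fields (a)–(e).

HONEST FRAMING: homological bookkeeping of landed theorems; no statement of a Summit, of Tate's theorem or of the crux is
proved here; 0 cells / labels / tiers move.

## References
* J. Neukirch, A. Schmidt, K. Wingberg, *Cohomology of Number Fields*, 2nd ed. (2008), VIII §3 (8.3.11), (1.5.1), I §6
  (1.6.4)–(1.6.5). [NeukirchSchmidtWingberg2008]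
* J.-P. Serre, *Cohomologie galoisienne* (1994), I §2.2 Prop. 8, §2.5 Prop. 10. [SerreGaloisCohomology1997]
* J.-P. Serre, *Local Fields*, GTM 67 (1979), Ch. VII §5. [SerreLocalFields1979]
-/

noncomputable section

open NumberField IsDedekindDomain Field Topology CategoryTheory CategoryTheory.Abelian groupCohomology Function
open Literature.NumberTheory.GaloisRepresentations.IdeleClassBar (GalLayer)
open Literature.NumberTheory.GaloisRepresentations.LocalWeilDatum (galFixing)
open Literature.NumberTheory.IwasawaTheory.Greenberg2006 (galoisGroupAbove)
open Literature.NumberTheory.GaloisRepresentations.OpenSubgroupLayer (algOfLE isScalarTower_algOfLE baseField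
  layerEquiv relEquiv layerSubgroup_le_of_le toAbove toAbove_surjective coe_layerEquiv_mk_eq_of_le)
open Literature.Algebra.Homology Literature.Algebra.Homology.DiscreteRep
open Literature.Algebra.Homology.DiscreteRep.LayerColimit (stepG inflG inflG_stepG stepG_stepG exists_inflG_eq
  exists_stepG_eq_zero)
open _root_.TopRep _root_.ContRepresentation _root_.ContinuousCohomology

/-! ### §0. Two generic facts: `I⁻¹ (I x) = x` in `ModuleCat`, and `shapiroFun` is onto -/

namespace Literature.Algebra.Homology.QuotientMaps

universe u

variable {k G : Type u} [CommRing k] [Group G] (S : Subgroup G) (A : Rep.{u} k G)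

/-- **The finite Shapiro map `shapiroFun` of the right-action model is onto** (it is `Hⁿ` of an isomorphism followed by
Mathlib's Shapiro isomorphism, `ShapiroExplicit.map_subtype_coindCounit_bijective`). [cite: SerreGaloisCohomology1997, I §2.5 Prop. 10] -/
theorem shapiroFun_surjective (n : ℕ) : Function.Surjective (shapiroFun S A n).hom := by
  intro z
  obtain ⟨f, hf⟩ := (map_subtype_coindCounit_bijective S (resSub S A) n).2 z
  refine ⟨(groupCohomology.map (MonoidHom.id G) (funRepIsoCoindSub S A).inv n).hom f, ?_⟩
  have h : groupCohomology.map (MonoidHom.id G) (funRepIsoCoindSub S A).inv n ≫ shapiroFun S A n =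
      groupCohomology.map S.subtype (coindEv S A) n := by
    rw [shapiroFun, ← Category.assoc, ← groupCohomology.map_id_comp, Iso.inv_hom_id]
    erw [groupCohomology.map_id]
    exact Category.id_comp _
  have h' := congrArg (fun φ => φ.hom f) h
  simp only [ModuleCat.hom_comp, LinearMap.comp_apply] at h'
  exact h'.trans hf

end Literature.Algebra.Homology.QuotientMaps

namespace Literature.NumberTheory.GaloisRepresentations

namespace SUnits

namespace Layers

/-- `I.inv (I.hom x) = x` for an isomorphism of `ModuleCat`, on elements. [folklore] -/
private theorem iso_inv_hom_apply {R : Type} [Ring R] {A B : ModuleCat R} (I : A ≅ B) (x : A) :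
    I.inv.hom (I.hom.hom x) = x := by
  have h := congrArg (fun φ => φ.hom x) I.hom_inv_id
  simpa only [ModuleCat.hom_comp, LinearMap.comp_apply, ModuleCat.hom_id, LinearMap.id_apply] using h

/-- `I.hom (I.inv y) = y` for an isomorphism of `ModuleCat`, on elements. [folklore] -/
private theorem iso_hom_inv_apply {R : Type} [Ring R] {A B : ModuleCat R} (I : A ≅ B) (y : B) :
    I.hom.hom (I.inv.hom y) = y := by
  have h := congrArg (fun φ => φ.hom y) I.inv_hom_id
  simpa only [ModuleCat.hom_comp, LinearMap.comp_apply, ModuleCat.hom_id, LinearMap.id_apply] using h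

variable {K : Type} [Field K] [NumberField K] {S : Set (HeightOneSpectrum (𝓞 K))}
  {H : Subgroup (absoluteGaloisGroup K)} (hHo : IsOpen (H : Set (absoluteGaloisGroup K)))
  {E E' : GalLayer K} (hEE' : E ≤ E') (hF : baseField H ≤ E.1)
  (hS : ramificationSubgroup K S ≤ galFixing K E.1) (hS' : ramificationSubgroup K S ≤ galFixing K E'.1)
  [CompactSpace ↥(galoisGroupAbove S H)]

/-! ### §1. `W = Gal(K_S/E)` is a compact, totally disconnected, finite-index open subgroup of `U` -/

/-- `W` is compact (open in the compact `U`). [cite: SerreGaloisCohomology1997, I §1.1] -/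
theorem compactSpace_layerW : CompactSpace ↥(layerW hHo E hF hS) :=
  compactSpace_subgroup_of_isOpen (U := (layerW hHo E hF hS)) (isOpen_layerW hHo E hF hS)

omit [CompactSpace ↥(galoisGroupAbove S H)] in
/-- `W` is totally disconnected. [cite: SerreGaloisCohomology1997, I §1.1] -/
theorem totallyDisconnectedSpace_layerW : TotallyDisconnectedSpace ↥(layerW hHo E hF hS) :=
  haveI := totallyDisconnectedSpace_above (S := S) (H := H)
  inferInstance

/-- `W` has finite index in `U`. [cite: SerreGaloisCohomology1997, I §1.1] -/
theorem finiteIndex_layerW : (layerW hHo E hF hS).FiniteIndex :=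
  haveI := Subgroup.quotient_finite_of_isOpen (layerW hHo E hF hS) (isOpen_layerW hHo E hF hS)
  Subgroup.finiteIndex_of_finite_quotient

section LayerW

variable [CompactSpace ↥(layerW hHo E hF hS)]

/-! ### §2. Boundary: G1 file 2's `J`, `J′` in -w2 g9's spelling (`M = stdBase ρ.toTopRep _`, `M_W = stdBase (resTop W ρ) _`) -/

/-- `J` of G1 file 2 on `Hⁿ(W̄, (E_S|_U)^V)` with the layer module spelled as in -w2's files (definitionally the same object,
`resD_eq`). [cite: NeukirchSchmidtWingberg2008, VIII §3] -/
def relIso :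
    letI := algOfLE (show E.1 ≤ E'.1 from hEE')
    groupCohomology (_root_.Literature.Algebra.Homology.resSub ((layerW hHo E hF hS).map (QuotientGroup.mk' ((OpenSubgroupLayer.layerSubgroup S hHo E' (hF.trans hEE') hS') : Subgroup ↥(galoisGroupAbove S H)))) ((invariantsQuotFunctor ℤ ((OpenSubgroupLayer.layerSubgroup S hHo E' (hF.trans hEE') hS') : Subgroup ↥(galoisGroupAbove S H))).obj (stdBase (resRep K S H).toTopRep (resRep K S H).isDiscrete_self))) 2 ≅ groupCohomology (sUnitsRep K S ↥E.1 ↥E'.1) 2 :=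
  letI := algOfLE (show E.1 ≤ E'.1 from hEE')
  relLayerCohomologyIso hHo hEE' hF hS hS' 2

omit [CompactSpace ↥(layerW hHo E hF hS)] in
/-- The conjugation dictionary of G1 file 2 in this spelling. [cite: SerreLocalFields1979, Ch. VII §5] -/
theorem relIso_hom_conjRepCohomology (g : ↥(galoisGroupAbove S H) ⧸ ((OpenSubgroupLayer.layerSubgroup S hHo E' (hF.trans hEE') hS') : Subgroup ↥(galoisGroupAbove S H)))
    (z : groupCohomology (_root_.Literature.Algebra.Homology.resSub ((layerW hHo E hF hS).map (QuotientGroup.mk' ((OpenSubgroupLayer.layerSubgroup S hHo E' (hF.trans hEE') hS') : Subgroup ↥(galoisGroupAbove S H)))) ((invariantsQuotFunctor ℤ ((OpenSubgroupLayer.layerSubgroup S hHo E' (hF.trans hEE') hS') : Subgroup ↥(galoisGroupAbove S H))).obj (stdBase (resRep K S H).toTopRep (resRep K S H).isDiscrete_self))) 2) :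
    letI := algOfLE hF
    letI := algOfLE (show E.1 ≤ E'.1 from hEE')
    letI := algOfLE (hF.trans (show E.1 ≤ E'.1 from hEE'))
    haveI := isScalarTower_algOfLE₃ hF (show E.1 ≤ E'.1 from hEE')
    haveI := E.isGalois
    haveI := normal_algOfLE (K := K) hF
    (relIso hHo hEE' hF hS hS').hom.hom (conjRepCohomology ((layerW hHo E hF hS).map (QuotientGroup.mk' ((OpenSubgroupLayer.layerSubgroup S hHo E' (hF.trans hEE') hS') : Subgroup ↥(galoisGroupAbove S H)))) ((invariantsQuotFunctor ℤ ((OpenSubgroupLayer.layerSubgroup S hHo E' (hF.trans hEE') hS') : Subgroup ↥(galoisGroupAbove S H))).obj (stdBase (resRep K S H).toTopRep (resRep K S H).isDiscrete_self)) 2 g z) =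
      sUnitsConj ↥(baseField H) ↥E.1 ↥E'.1 S (OpenSubgroupLayer.layerEquiv S hHo E' (hF.trans hEE') hS' g) 2 ((relIso hHo hEE' hF hS hS').hom.hom z) :=
  letI := algOfLE hF
  letI := algOfLE (show E.1 ≤ E'.1 from hEE')
  letI := algOfLE (hF.trans (show E.1 ≤ E'.1 from hEE'))
  haveI := isScalarTower_algOfLE₃ hF (show E.1 ≤ E'.1 from hEE')
  haveI := E.isGalois
  haveI := normal_algOfLE (K := K) hF
  relLayerCohomologyIso_hom_conjRepCohomology hHo hEE' hF hS hS' 2 g z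

/-- `J′` of G1 file 2 on the `↥W`-layer `Hⁿ(↥W ⧸ (V ∩ W), (E_S|_W)^{V∩W})` with `M_W = stdBase (resTop W ρ) _` (definitionally the
same object, `resD_stdBase`). [cite: NeukirchSchmidtWingberg2008, VIII §3 (8.3.11)] -/
def traceIso :
    letI := algOfLE (show E.1 ≤ E'.1 from hEE')
    groupCohomology ((invariantsQuotFunctor ℤ (traceOpenNormalSubgroup (layerW hHo E hF hS) (OpenSubgroupLayer.layerSubgroup S hHo E' (hF.trans hEE') hS') : Subgroup ↥(layerW hHo E hF hS))).obj (stdBase (resTop (layerW hHo E hF hS) (resRep K S H).toTopRep) (isDiscrete_resTop (layerW hHo E hF hS) (resRep K S H).isDiscrete_self))) 2 ≅ groupCohomology (sUnitsRep K S ↥E.1 ↥E'.1) 2 :=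
  letI := algOfLE (show E.1 ≤ E'.1 from hEE')
  traceLayerCohomologyIso hHo hEE' hF hS hS' 2

/-- The transition formula of G1 file 2 in this spelling: `J′_{E″} (stepG z) = layerInf (J′_{E′} z)`.
[cite: SerreGaloisCohomology1997, I §2.2 Prop. 8] -/
theorem traceIso_hom_stepG {E'' : GalLayer K} (hE'E'' : E' ≤ E'')
    (hS'' : ramificationSubgroup K S ≤ galFixing K E''.1) (z : groupCohomology ((invariantsQuotFunctor ℤ (traceOpenNormalSubgroup (layerW hHo E hF hS) (OpenSubgroupLayer.layerSubgroup S hHo E' (hF.trans hEE') hS') : Subgroup ↥(layerW hHo E hF hS))).obj (stdBase (resTop (layerW hHo E hF hS) (resRep K S H).toTopRep) (isDiscrete_resTop (layerW hHo E hF hS) (resRep K S H).isDiscrete_self))) 2) :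
    letI := algOfLE (show E.1 ≤ E'.1 from hEE')
    letI := algOfLE (show E.1 ≤ E''.1 from hEE'.trans hE'E'')
    haveI := E'.isGalois
    (traceIso hHo (hEE'.trans hE'E'') hF hS hS'').hom.hom
        (stepG (traceOpenNormalSubgroup (layerW hHo E hF hS) (OpenSubgroupLayer.layerSubgroup S hHo E' (hF.trans hEE') hS')) (traceOpenNormalSubgroup (layerW hHo E hF hS) (OpenSubgroupLayer.layerSubgroup S hHo E'' (hF.trans (hEE'.trans hE'E'')) hS''))
          (traceOpenNormalSubgroup_mono _ (layerSubgroup_le_of_le S hHo hE'E'' (hF.trans hEE') hS' hS'')) (stdBase (resTop (layerW hHo E hF hS) (resRep K S H).toTopRep) (isDiscrete_resTop (layerW hHo E hF hS) (resRep K S H).isDiscrete_self)) 2 z) =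
      layerInf S (show E.1 ≤ E'.1 from hEE') (show E'.1 ≤ E''.1 from hE'E'') 2 ((traceIso hHo hEE' hF hS hS').hom.hom z) :=
  letI := algOfLE (show E.1 ≤ E'.1 from hEE')
  letI := algOfLE (show E.1 ≤ E''.1 from hEE'.trans hE'E'')
  haveI := E'.isGalois
  traceLayerCohomologyIso_hom_stepG hHo hEE' hF hS hS' hE'E'' hS'' 2 z

/-- `J′ ∘ Hⁿ(κ, λ) = J` of G1 file 2 in this spelling, with -w2's `λ = traceLayerHomRange` (the same morphism as G1 file 2's
`λ′ = traceLayerHom'`, definitionally). [cite: SerreGaloisCohomology1997, I §2.2 Prop. 8] -/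
theorem traceIso_hom_map_traceQuotMapRange
    (w : groupCohomology (_root_.Literature.Algebra.Homology.resSub ((layerW hHo E hF hS).map (QuotientGroup.mk' ((OpenSubgroupLayer.layerSubgroup S hHo E' (hF.trans hEE') hS') : Subgroup ↥(galoisGroupAbove S H)))) ((invariantsQuotFunctor ℤ ((OpenSubgroupLayer.layerSubgroup S hHo E' (hF.trans hEE') hS') : Subgroup ↥(galoisGroupAbove S H))).obj (stdBase (resRep K S H).toTopRep (resRep K S H).isDiscrete_self))) 2) :
    letI := algOfLE (show E.1 ≤ E'.1 from hEE')
    (traceIso hHo hEE' hF hS hS').hom.hom ((groupCohomology.map (ContinuousRep.traceQuotMapRange (layerW hHo E hF hS) (OpenSubgroupLayer.layerSubgroup S hHo E' (hF.trans hEE') hS')) ((resRep K S H).traceLayerHomRange (layerW hHo E hF hS) (OpenSubgroupLayer.layerSubgroup S hHo E' (hF.trans hEE') hS')) 2).hom w) = (relIso hHo hEE' hF hS hS').hom.hom w :=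
  letI := algOfLE (show E.1 ≤ E'.1 from hEE')
  traceLayerCohomologyIso_hom_map_traceQuotMapRange hHo hEE' hF hS hS' 2 w

/-! ### §3. `toCoindW = sh⁻¹ ∘ Φ_W : Ext²_{C_W}(ℤ, E_S|_W) →+ 𝓗²` -/

/-- Door-c4's comparison `Φ_W : Ext²_{C_W}(ℤ, E_S|_W) ≃+ H²_cont(W, E_S|_W)`, with the codomain spelled as the codomain of the
continuous Shapiro isomorphism `sh` (`(ρ.restrict (subgroupIncl W)).toTopRep = resTop W ρ.toTopRep`, definitionally; reducible).
[cite: SerreGaloisCohomology1997, I §2.5 Prop. 10] -/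
abbrev phiW :
    haveI := totallyDisconnectedSpace_above (S := S) (H := H)
    Ext (triv (Γ := ↥(layerW hHo E hF hS)) ℤ) (stdBase (resTop (layerW hHo E hF hS) (resRep K S H).toTopRep) (isDiscrete_resTop (layerW hHo E hF hS) (resRep K S H).isDiscrete_self)) 2 ≃+
      continuousCohomology 2 ((resRep K S H).restrict (subgroupIncl (layerW hHo E hF hS))).toTopRep :=
  (extTrivAddEquivContinuousCohomology (resTop (layerW hHo E hF hS) (resRep K S H).toTopRep) (isDiscrete_resTop (layerW hHo E hF hS) (resRep K S H).isDiscrete_self) 2)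

/-- **`toCoindW := sh⁻¹ ∘ Φ_W`**: door-c4's comparison `Ext²_{C_W}(ℤ, E_S|_W) ≃ H²_cont(W, E_S|_W)` followed by the inverse of
the continuous Shapiro isomorphism `𝓗² = H²(U, Maps(U⧸W, E_S)) ≃ H²(W, E_S|_W)`.
[cite: SerreGaloisCohomology1997, I §2.5 Prop. 10] -/
def toCoindW : Ext (triv (Γ := ↥(layerW hHo E hF hS)) ℤ) (stdBase (resTop (layerW hHo E hF hS) (resRep K S H).toTopRep) (isDiscrete_resTop (layerW hHo E hF hS) (resRep K S H).isDiscrete_self)) 2 →+ coindH2 hHo E hF hS :=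
  haveI := totallyDisconnectedSpace_above (S := S) (H := H)
  ((resRep K S H).shapiroOpenAddEquiv (layerW hHo E hF hS) (isOpen_layerW hHo E hF hS) 2).symm.toAddMonoidHom.comp (phiW hHo hF hS).toAddMonoidHom

/-- Formula. [cite: SerreGaloisCohomology1997, I §2.5 Prop. 10] -/
theorem toCoindW_apply (e : Ext (triv (Γ := ↥(layerW hHo E hF hS)) ℤ) (stdBase (resTop (layerW hHo E hF hS) (resRep K S H).toTopRep) (isDiscrete_resTop (layerW hHo E hF hS) (resRep K S H).isDiscrete_self)) 2) :
    haveI := totallyDisconnectedSpace_above (S := S) (H := H)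
    toCoindW hHo hF hS e = ((resRep K S H).shapiroOpenAddEquiv (layerW hHo E hF hS) (isOpen_layerW hHo E hF hS) 2).symm ((phiW hHo hF hS) e) := rfl

/-- `sh (toCoindW e) = Φ_W e`. [cite: SerreGaloisCohomology1997, I §2.5 Prop. 10] -/
theorem shapiroOpenAddEquiv_toCoindW (e : Ext (triv (Γ := ↥(layerW hHo E hF hS)) ℤ) (stdBase (resTop (layerW hHo E hF hS) (resRep K S H).toTopRep) (isDiscrete_resTop (layerW hHo E hF hS) (resRep K S H).isDiscrete_self)) 2) :
    haveI := totallyDisconnectedSpace_above (S := S) (H := H)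
    ((resRep K S H).shapiroOpenAddEquiv (layerW hHo E hF hS) (isOpen_layerW hHo E hF hS) 2) (toCoindW hHo hF hS e) = (phiW hHo hF hS) e := by
  rw [toCoindW_apply, AddEquiv.apply_symm_apply]

/-- `toCoindW (Φ_W⁻¹ (sh y)) = y`. [cite: SerreGaloisCohomology1997, I §2.5 Prop. 10] -/
theorem toCoindW_symm_shapiroOpenAddEquiv (y : coindH2 hHo E hF hS) :
    haveI := totallyDisconnectedSpace_above (S := S) (H := H)
    toCoindW hHo hF hS ((phiW hHo hF hS).symm (((resRep K S H).shapiroOpenAddEquiv (layerW hHo E hF hS) (isOpen_layerW hHo E hF hS) 2) y)) = y := by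
  rw [toCoindW_apply, AddEquiv.apply_symm_apply, AddEquiv.symm_apply_apply]

/-- `toCoindW` is injective. [cite: SerreGaloisCohomology1997, I §2.5 Prop. 10] -/
theorem toCoindW_injective : Function.Injective (toCoindW hHo hF hS) :=
  haveI := totallyDisconnectedSpace_above (S := S) (H := H)
  ((resRep K S H).shapiroOpenAddEquiv (layerW hHo E hF hS) (isOpen_layerW hHo E hF hS) 2).symm.injective.comp (phiW hHo hF hS).injective

/-! ### §4. (a) The layer maps `H²(Gal(E′/E), 𝒪_{E′,S}ˣ) → 𝓗²` and (b)–(d) -/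

/-- **(a) `layerToCoind E′ := toCoindW ∘ Inf^W_{V′ ∩ W} ∘ (J′_{E′})⁻¹ : H²(Gal(E′/E), 𝒪_{E′,S}ˣ) →+ 𝓗²`.**
[cite: NeukirchSchmidtWingberg2008, VIII §3 (8.3.11), I §6 (1.6.4)] [cite: SerreGaloisCohomology1997, I §2.2 Prop. 8] -/
def layerToCoind :
    (letI := algOfLE (show E.1 ≤ E'.1 from hEE'); groupCohomology (sUnitsRep K S ↥E.1 ↥E'.1) 2) →+ coindH2 hHo E hF hS :=
  letI := algOfLE (show E.1 ≤ E'.1 from hEE')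
  { toFun := fun c => toCoindW hHo hF hS (inflG (traceOpenNormalSubgroup (layerW hHo E hF hS) (OpenSubgroupLayer.layerSubgroup S hHo E' (hF.trans hEE') hS')) (stdBase (resTop (layerW hHo E hF hS) (resRep K S H).toTopRep) (isDiscrete_resTop (layerW hHo E hF hS) (resRep K S H).isDiscrete_self)) 2 ((traceIso hHo hEE' hF hS hS').inv.hom c))
    map_zero' := by simp only [map_zero]
    map_add' := fun _ _ => by simp only [map_add] }

set_option maxRecDepth 8192 in
/-- Formula. [cite: NeukirchSchmidtWingberg2008, VIII §3 (8.3.11)] -/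
theorem layerToCoind_apply
    (c : letI := algOfLE (show E.1 ≤ E'.1 from hEE'); groupCohomology (sUnitsRep K S ↥E.1 ↥E'.1) 2) :
    letI := algOfLE (show E.1 ≤ E'.1 from hEE')
    layerToCoind hHo hEE' hF hS hS' c =
      toCoindW hHo hF hS (inflG (traceOpenNormalSubgroup (layerW hHo E hF hS) (OpenSubgroupLayer.layerSubgroup S hHo E' (hF.trans hEE') hS')) (stdBase (resTop (layerW hHo E hF hS) (resRep K S H).toTopRep) (isDiscrete_resTop (layerW hHo E hF hS) (resRep K S H).isDiscrete_self)) 2 ((traceIso hHo hEE' hF hS hS').inv.hom c)) :=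
  rfl

/-- `layerToCoind (J′ z) = toCoindW (Inf z)` for a `↥W`-layer class `z`. [cite: NeukirchSchmidtWingberg2008, VIII §3 (8.3.11)] -/
theorem layerToCoind_hom_apply (z : groupCohomology ((invariantsQuotFunctor ℤ (traceOpenNormalSubgroup (layerW hHo E hF hS) (OpenSubgroupLayer.layerSubgroup S hHo E' (hF.trans hEE') hS') : Subgroup ↥(layerW hHo E hF hS))).obj (stdBase (resTop (layerW hHo E hF hS) (resRep K S H).toTopRep) (isDiscrete_resTop (layerW hHo E hF hS) (resRep K S H).isDiscrete_self))) 2) :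
    letI := algOfLE (show E.1 ≤ E'.1 from hEE')
    layerToCoind hHo hEE' hF hS hS' ((traceIso hHo hEE' hF hS hS').hom.hom z) =
      toCoindW hHo hF hS (inflG (traceOpenNormalSubgroup (layerW hHo E hF hS) (OpenSubgroupLayer.layerSubgroup S hHo E' (hF.trans hEE') hS')) (stdBase (resTop (layerW hHo E hF hS) (resRep K S H).toTopRep) (isDiscrete_resTop (layerW hHo E hF hS) (resRep K S H).isDiscrete_self)) 2 z) := by
  letI := algOfLE (show E.1 ≤ E'.1 from hEE')
  rw [layerToCoind_apply, iso_inv_hom_apply]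

/-- **(b) compatibility with inflation: `layerToCoind E″ (layerInf c) = layerToCoind E′ c`** (`E ≤ E′ ≤ E″`).
[cite: SerreGaloisCohomology1997, I §2.2 Prop. 8] [cite: NeukirchSchmidtWingberg2008, VIII §3 (8.3.11)] -/
theorem layerToCoind_layerInf {E'' : GalLayer K} (hE'E'' : E' ≤ E'')
    (hS'' : ramificationSubgroup K S ≤ galFixing K E''.1)
    (c : letI := algOfLE (show E.1 ≤ E'.1 from hEE'); groupCohomology (sUnitsRep K S ↥E.1 ↥E'.1) 2) :
    haveI := E'.isGalois
    layerToCoind hHo (hEE'.trans hE'E'') hF hS hS''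
        (layerInf S (show E.1 ≤ E'.1 from hEE') (show E'.1 ≤ E''.1 from hE'E'') 2 c) =
      layerToCoind hHo hEE' hF hS hS' c := by
  letI := algOfLE (show E.1 ≤ E'.1 from hEE')
  letI := algOfLE (show E.1 ≤ E''.1 from hEE'.trans hE'E'')
  haveI := E'.isGalois
  have hc : c = (traceIso hHo hEE' hF hS hS').hom.hom ((traceIso hHo hEE' hF hS hS').inv.hom c) := (iso_hom_inv_apply _ c).symm
  conv_lhs => rw [hc]
  rw [← traceIso_hom_stepG hHo hEE' hF hS hS' hE'E'' hS'', layerToCoind_hom_apply, inflG_stepG,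
    ← layerToCoind_apply]

/-- **(c) joint surjectivity: every class of `𝓗²` is `layerToCoind E′ c` for some layer `E′ ≥ E` inside `K_S`** (door-c4's
`exists_inflG_eq` for `↥W` and `E_S|_W`, then cofinality of the layer traces in `W`). [cite: SerreGaloisCohomology1997, I §2.2 Prop. 8] -/
theorem exists_layerToCoind_eq (hNH : ramificationSubgroup K S ≤ H) (y : coindH2 hHo E hF hS) :
    ∃ (E' : GalLayer K) (hEE' : E ≤ E') (hS' : ramificationSubgroup K S ≤ galFixing K E'.1)
      (c : letI := algOfLE (show E.1 ≤ E'.1 from hEE'); groupCohomology (sUnitsRep K S ↥E.1 ↥E'.1) 2),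
      layerToCoind hHo hEE' hF hS hS' c = y := by
  haveI := totallyDisconnectedSpace_layerW hHo hF hS
  haveI := finiteIndex_layerW hHo hF hS
  haveI := totallyDisconnectedSpace_above (S := S) (H := H)
  obtain ⟨V₁, c₁, h₁⟩ := exists_inflG_eq (Γ := ↥(layerW hHo E hF hS)) 2 (stdBase (resTop (layerW hHo E hF hS) (resRep K S H).toTopRep) (isDiscrete_resTop (layerW hHo E hF hS) (resRep K S H).isDiscrete_self)) ((phiW hHo hF hS).symm (((resRep K S H).shapiroOpenAddEquiv (layerW hHo E hF hS) (isOpen_layerW hHo E hF hS) 2) y))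
  obtain ⟨E', hEE', hS', hle⟩ := OpenSubgroupLayer.exists_layer_traceOpenNormalSubgroup_le S hHo hF hS hNH V₁
  letI := algOfLE (show E.1 ≤ E'.1 from hEE')
  refine ⟨E', hEE', hS', (traceIso hHo hEE' hF hS hS').hom.hom (stepG V₁ (traceOpenNormalSubgroup (layerW hHo E hF hS) (OpenSubgroupLayer.layerSubgroup S hHo E' (hF.trans hEE') hS')) hle (stdBase (resTop (layerW hHo E hF hS) (resRep K S H).toTopRep) (isDiscrete_resTop (layerW hHo E hF hS) (resRep K S H).isDiscrete_self)) 2 c₁), ?_⟩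
  rw [layerToCoind_hom_apply, inflG_stepG, h₁, toCoindW_symm_shapiroOpenAddEquiv]

include hS' in
omit [NumberField K] [CompactSpace ↥(galoisGroupAbove S H)] in
/-- `N_S ≤ Gal(K̄/(E′ ⊔ E₁))` for two layers inside `K_S`. [cite: NeukirchSchmidtWingberg2008, VIII §3] -/
private theorem ramificationSubgroup_le_galFixing_sup' {E₁ : GalLayer K}
    (hS₁ : ramificationSubgroup K S ≤ galFixing K E₁.1) :
    ramificationSubgroup K S ≤ galFixing K (GalLayer.sup E' E₁).1 := by
  change ramificationSubgroup K S ≤ galFixing K (E'.1 ⊔ E₁.1)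
  rw [LocalWeilDatum.galFixing_sup]
  exact le_inf hS' hS₁

/-- (d), step 1: if `layerToCoind E′ c = 0` then the `↥W`-layer class of `c` dies in `Ext²_{C_W}(ℤ, E_S|_W)` (`toCoindW` is
injective). [cite: SerreGaloisCohomology1997, I §2.2 Prop. 8] -/
theorem inflG_eq_zero_of_layerToCoind_eq_zero
    (c : letI := algOfLE (show E.1 ≤ E'.1 from hEE'); groupCohomology (sUnitsRep K S ↥E.1 ↥E'.1) 2)
    (h0 : layerToCoind hHo hEE' hF hS hS' c = 0) :
    letI := algOfLE (show E.1 ≤ E'.1 from hEE')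
    inflG (traceOpenNormalSubgroup (layerW hHo E hF hS) (OpenSubgroupLayer.layerSubgroup S hHo E' (hF.trans hEE') hS')) (stdBase (resTop (layerW hHo E hF hS) (resRep K S H).toTopRep) (isDiscrete_resTop (layerW hHo E hF hS) (resRep K S H).isDiscrete_self)) 2 ((traceIso hHo hEE' hF hS hS').inv.hom c) = 0 := by
  apply toCoindW_injective hHo hF hS
  rw [map_zero, ← layerToCoind_apply, h0]

/-- (d), step 2: a `↥W`-layer class that dies in the limit dies in the layer of some bigger `E″ ≥ E′` inside `K_S` (door-c4's
`exists_stepG_eq_zero`, cofinality of the layer traces, `stepG_stepG`). [cite: SerreGaloisCohomology1997, I §2.2 Prop. 8] -/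
theorem exists_layer_stepG_eq_zero (hNH : ramificationSubgroup K S ≤ H)
    (z : groupCohomology ((invariantsQuotFunctor ℤ (traceOpenNormalSubgroup (layerW hHo E hF hS) (OpenSubgroupLayer.layerSubgroup S hHo E' (hF.trans hEE') hS') : Subgroup ↥(layerW hHo E hF hS))).obj (stdBase (resTop (layerW hHo E hF hS) (resRep K S H).toTopRep) (isDiscrete_resTop (layerW hHo E hF hS) (resRep K S H).isDiscrete_self))) 2)
    (h1 : inflG (traceOpenNormalSubgroup (layerW hHo E hF hS) (OpenSubgroupLayer.layerSubgroup S hHo E' (hF.trans hEE') hS')) (stdBase (resTop (layerW hHo E hF hS) (resRep K S H).toTopRep) (isDiscrete_resTop (layerW hHo E hF hS) (resRep K S H).isDiscrete_self)) 2 z = 0) :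
    ∃ (E'' : GalLayer K) (hE'E'' : E' ≤ E'') (hS'' : ramificationSubgroup K S ≤ galFixing K E''.1),
      stepG (traceOpenNormalSubgroup (layerW hHo E hF hS) (OpenSubgroupLayer.layerSubgroup S hHo E' (hF.trans hEE') hS'))
        (traceOpenNormalSubgroup (layerW hHo E hF hS) (OpenSubgroupLayer.layerSubgroup S hHo E'' (hF.trans (hEE'.trans hE'E'')) hS''))
        (traceOpenNormalSubgroup_mono _ (layerSubgroup_le_of_le S hHo hE'E'' (hF.trans hEE') hS' hS'')) (stdBase (resTop (layerW hHo E hF hS) (resRep K S H).toTopRep) (isDiscrete_resTop (layerW hHo E hF hS) (resRep K S H).isDiscrete_self)) 2 z = 0 := by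
  haveI := totallyDisconnectedSpace_layerW hHo hF hS
  haveI := totallyDisconnectedSpace_above (S := S) (H := H)
  obtain ⟨V₂, h₂, hz⟩ := exists_stepG_eq_zero (Γ := ↥(layerW hHo E hF hS)) 2 (stdBase (resTop (layerW hHo E hF hS) (resRep K S H).toTopRep) (isDiscrete_resTop (layerW hHo E hF hS) (resRep K S H).isDiscrete_self)) _ z h1
  obtain ⟨E₁, hEE₁, hS₁, hle⟩ := OpenSubgroupLayer.exists_layer_traceOpenNormalSubgroup_le S hHo hF hS hNH V₂
  refine ⟨GalLayer.sup E' E₁, le_sup_left (a := E'.1) (b := E₁.1), ramificationSubgroup_le_galFixing_sup' hS' hS₁, ?_⟩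
  have hle' : (traceOpenNormalSubgroup (layerW hHo E hF hS)
      (OpenSubgroupLayer.layerSubgroup S hHo (GalLayer.sup E' E₁)
        (hF.trans (hEE'.trans (le_sup_left (a := E'.1) (b := E₁.1)))) (ramificationSubgroup_le_galFixing_sup' hS' hS₁)) :
        Subgroup ↥(layerW hHo E hF hS)) ≤ V₂ :=
    le_trans (traceOpenNormalSubgroup_mono _ (OpenSubgroupLayer.layerSubgroup_anti S hHo
      (le_sup_right (a := E'.1) (b := E₁.1)) (hF.trans hEE₁) (ramificationSubgroup_le_galFixing_sup' hS' hS₁))) hle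
  rw [← stepG_stepG _ V₂ h₂ (stdBase (resTop (layerW hHo E hF hS) (resRep K S H).toTopRep) (isDiscrete_resTop (layerW hHo E hF hS) (resRep K S H).isDiscrete_self)) 2 _ hle', hz, map_zero]

/-- **(d) the kernel of `layerToCoind E′` is killed by inflation to a bigger layer** (steps 1–2 and the transition formula
`J′_{E″} ∘ stepG = layerInf ∘ J′_{E′}`). [cite: SerreGaloisCohomology1997, I §2.2 Prop. 8] [cite: NeukirchSchmidtWingberg2008, VIII §3 (8.3.11)] -/
theorem exists_layerInf_eq_zero_of_layerToCoind_eq_zero (hNH : ramificationSubgroup K S ≤ H)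
    (c : letI := algOfLE (show E.1 ≤ E'.1 from hEE'); groupCohomology (sUnitsRep K S ↥E.1 ↥E'.1) 2)
    (h0 : layerToCoind hHo hEE' hF hS hS' c = 0) :
    ∃ (E'' : GalLayer K) (hE'E'' : E' ≤ E'') (_ : ramificationSubgroup K S ≤ galFixing K E''.1),
      haveI := E'.isGalois
      layerInf S (show E.1 ≤ E'.1 from hEE') (show E'.1 ≤ E''.1 from hE'E'') 2 c = 0 := by
  letI := algOfLE (show E.1 ≤ E'.1 from hEE')
  haveI := E'.isGalois
  obtain ⟨E'', hE'E'', hS'', hz⟩ := exists_layer_stepG_eq_zero hHo hEE' hF hS hS' hNH _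
    (inflG_eq_zero_of_layerToCoind_eq_zero hHo hEE' hF hS hS' c h0)
  refine ⟨E'', hE'E'', hS'', ?_⟩
  letI := algOfLE (show E.1 ≤ E''.1 from hEE'.trans hE'E'')
  have hc : c = (traceIso hHo hEE' hF hS hS').hom.hom ((traceIso hHo hEE' hF hS hS').inv.hom c) := (iso_hom_inv_apply _ c).symm
  rw [hc, ← traceIso_hom_stepG hHo hEE' hF hS hS' hE'E'' hS'', hz, map_zero]

/-! ### §5. (e) The `Δ`-action: `R_d ∘ layerToCoind E′ = layerToCoind E′ ∘ σ_t` for `d = t|_E` -/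

/-- `J′⁻¹ ∘ J = Hⁿ(κ, λ)` on elements (§2). [cite: SerreGaloisCohomology1997, I §2.2 Prop. 8] -/
theorem traceIso_inv_relIso_hom
    (w : groupCohomology (_root_.Literature.Algebra.Homology.resSub ((layerW hHo E hF hS).map (QuotientGroup.mk' ((OpenSubgroupLayer.layerSubgroup S hHo E' (hF.trans hEE') hS') : Subgroup ↥(galoisGroupAbove S H)))) ((invariantsQuotFunctor ℤ ((OpenSubgroupLayer.layerSubgroup S hHo E' (hF.trans hEE') hS') : Subgroup ↥(galoisGroupAbove S H))).obj (stdBase (resRep K S H).toTopRep (resRep K S H).isDiscrete_self))) 2) :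
    letI := algOfLE (show E.1 ≤ E'.1 from hEE')
    (traceIso hHo hEE' hF hS hS').inv.hom ((relIso hHo hEE' hF hS hS').hom.hom w) = (groupCohomology.map (ContinuousRep.traceQuotMapRange (layerW hHo E hF hS) (OpenSubgroupLayer.layerSubgroup S hHo E' (hF.trans hEE') hS')) ((resRep K S H).traceLayerHomRange (layerW hHo E hF hS) (OpenSubgroupLayer.layerSubgroup S hHo E' (hF.trans hEE') hS')) 2).hom w := by
  letI := algOfLE (show E.1 ≤ E'.1 from hEE')
  rw [← traceIso_hom_map_traceQuotMapRange hHo hEE' hF hS hS' w, iso_inv_hom_apply]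

set_option maxRecDepth 8192 in
set_option maxHeartbeats 1600000 in
/-- **A class `layerToCoind E′ c` read through a `U`-layer representative**: if `y` is a class of the `funRep`-layer
`H²(U⧸V′, Maps((U⧸V′)⧸W̄, (E_S)^{V′}))` with `J (shapiroFun y) = c`, then `layerToCoind E′ c = Φ_U (Inf^U_{V′} (iso⁻¹ y))`
(-w2 g9's `shapiroOpenAddEquiv_extTriv_inflG` and §2). [cite: SerreGaloisCohomology1997, I §2.5 Prop. 10] [cite: NeukirchSchmidtWingberg2008, I §6 (1.6.4)] -/
theorem layerToCoind_eq_of_shapiroFun_eq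
    (c : letI := algOfLE (show E.1 ≤ E'.1 from hEE'); groupCohomology (sUnitsRep K S ↥E.1 ↥E'.1) 2)
    (y : (groupCohomology (PermutationDual.funRep ((invariantsQuotFunctor ℤ ((OpenSubgroupLayer.layerSubgroup S hHo E' (hF.trans hEE') hS') : Subgroup ↥(galoisGroupAbove S H))).obj (stdBase (resRep K S H).toTopRep (resRep K S H).isDiscrete_self)) ((↥(galoisGroupAbove S H) ⧸ ((OpenSubgroupLayer.layerSubgroup S hHo E' (hF.trans hEE') hS') : Subgroup ↥(galoisGroupAbove S H))) ⧸ ((layerW hHo E hF hS).map (QuotientGroup.mk' ((OpenSubgroupLayer.layerSubgroup S hHo E' (hF.trans hEE') hS') : Subgroup ↥(galoisGroupAbove S H)))))) 2))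
    (hy : letI := algOfLE (show E.1 ≤ E'.1 from hEE')
      haveI := isScalarTower_algOfLE (K := K) (show E.1 ≤ E'.1 from hEE')
      (relIso hHo hEE' hF hS hS').hom.hom ((QuotientMaps.shapiroFun ((layerW hHo E hF hS).map (QuotientGroup.mk' ((OpenSubgroupLayer.layerSubgroup S hHo E' (hF.trans hEE') hS') : Subgroup ↥(galoisGroupAbove S H)))) ((invariantsQuotFunctor ℤ ((OpenSubgroupLayer.layerSubgroup S hHo E' (hF.trans hEE') hS') : Subgroup ↥(galoisGroupAbove S H))).obj (stdBase (resRep K S H).toTopRep (resRep K S H).isDiscrete_self)) 2).hom y) = c) :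
    layerToCoind hHo hEE' hF hS hS' c =
      (extTrivAddEquivContinuousCohomology ((resRep K S H).coindOpen (layerW hHo E hF hS) (isOpen_layerW hHo E hF hS)).toTopRep ((resRep K S H).isDiscrete_coindOpen (layerW hHo E hF hS) (isOpen_layerW hHo E hF hS)) 2)
        (inflG (OpenSubgroupLayer.layerSubgroup S hHo E' (hF.trans hEE') hS') (stdBase ((resRep K S H).coindOpen (layerW hHo E hF hS) (isOpen_layerW hHo E hF hS)).toTopRep ((resRep K S H).isDiscrete_coindOpen (layerW hHo E hF hS) (isOpen_layerW hHo E hF hS))) 2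
          ((groupCohomology.map (MonoidHom.id _) ((resRep K S H).coindOpenLayerIso (layerW hHo E hF hS) (isOpen_layerW hHo E hF hS) (OpenSubgroupLayer.layerSubgroup S hHo E' (hF.trans hEE') hS') (layerSubgroup_le_of_le S hHo hEE' hF hS hS') (ContinuousRep.discreteTopology_coindOpen (layerW hHo E hF hS) (isOpen_layerW hHo E hF hS))).inv 2).hom y)) := by
  haveI := totallyDisconnectedSpace_layerW hHo hF hS
  haveI := finiteIndex_layerW hHo hF hS
  haveI := totallyDisconnectedSpace_above (S := S) (H := H)
  letI := algOfLE (show E.1 ≤ E'.1 from hEE')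
  apply ((resRep K S H).shapiroOpenAddEquiv (layerW hHo E hF hS) (isOpen_layerW hHo E hF hS) 2).injective
  have hsh := (resRep K S H).shapiroOpenAddEquiv_extTriv_inflG (layerW hHo E hF hS) (isOpen_layerW hHo E hF hS) (ContinuousRep.discreteTopology_coindOpen (layerW hHo E hF hS) (isOpen_layerW hHo E hF hS)) (OpenSubgroupLayer.layerSubgroup S hHo E' (hF.trans hEE') hS') (layerSubgroup_le_of_le S hHo hEE' hF hS hS') 2 y
  refine Eq.trans ?_ hsh.symm
  rw [layerToCoind_apply, shapiroOpenAddEquiv_toCoindW, ← hy, traceIso_inv_relIso_hom]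
  rfl

set_option maxRecDepth 8192 in
omit [CompactSpace ↥(layerW hHo E hF hS)] in
/-- A `U`-layer representative of `c`: some class `y` of the `funRep`-layer has `J (shapiroFun y) = c` (`shapiroFun` onto, `J` an
isomorphism). [cite: SerreGaloisCohomology1997, I §2.5 Prop. 10] -/
theorem exists_relIso_shapiroFun_eq
    (c : letI := algOfLE (show E.1 ≤ E'.1 from hEE'); groupCohomology (sUnitsRep K S ↥E.1 ↥E'.1) 2) :
    ∃ y : (groupCohomology (PermutationDual.funRep ((invariantsQuotFunctor ℤ ((OpenSubgroupLayer.layerSubgroup S hHo E' (hF.trans hEE') hS') : Subgroup ↥(galoisGroupAbove S H))).obj (stdBase (resRep K S H).toTopRep (resRep K S H).isDiscrete_self)) ((↥(galoisGroupAbove S H) ⧸ ((OpenSubgroupLayer.layerSubgroup S hHo E' (hF.trans hEE') hS') : Subgroup ↥(galoisGroupAbove S H))) ⧸ ((layerW hHo E hF hS).map (QuotientGroup.mk' ((OpenSubgroupLayer.layerSubgroup S hHo E' (hF.trans hEE') hS') : Subgroup ↥(galoisGroupAbove S H)))))) 2),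
      letI := algOfLE (show E.1 ≤ E'.1 from hEE')
      (relIso hHo hEE' hF hS hS').hom.hom ((QuotientMaps.shapiroFun ((layerW hHo E hF hS).map (QuotientGroup.mk' ((OpenSubgroupLayer.layerSubgroup S hHo E' (hF.trans hEE') hS') : Subgroup ↥(galoisGroupAbove S H)))) ((invariantsQuotFunctor ℤ ((OpenSubgroupLayer.layerSubgroup S hHo E' (hF.trans hEE') hS') : Subgroup ↥(galoisGroupAbove S H))).obj (stdBase (resRep K S H).toTopRep (resRep K S H).isDiscrete_self)) 2).hom y) = c := by
  letI := algOfLE (show E.1 ≤ E'.1 from hEE')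
  obtain ⟨y, hy⟩ := QuotientMaps.shapiroFun_surjective ((layerW hHo E hF hS).map (QuotientGroup.mk' ((OpenSubgroupLayer.layerSubgroup S hHo E' (hF.trans hEE') hS') : Subgroup ↥(galoisGroupAbove S H)))) ((invariantsQuotFunctor ℤ ((OpenSubgroupLayer.layerSubgroup S hHo E' (hF.trans hEE') hS') : Subgroup ↥(galoisGroupAbove S H))).obj (stdBase (resRep K S H).toTopRep (resRep K S H).isDiscrete_self)) 2 ((relIso hHo hEE' hF hS hS').inv.hom c)
  exact ⟨y, by rw [hy, iso_hom_inv_apply]⟩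

set_option maxRecDepth 8192 in
set_option maxHeartbeats 1600000 in
/-- **(e), core form: `R_{[u]} (layerToCoind E′ c) = layerToCoind E′ (σ_{layerEquiv E′ [u]} c)`** for `u ∈ U`: a `U`-layer
representative `y` of `c` is moved by `R_{[u]}` to `Hⁿ(rTrans [u]) y` (-w2 g9's `coindOpenHRep_layer_conj`), whose finite Shapiro
image is `conjRepCohomology [u] (J⁻¹ c) = J⁻¹ (σ c)` (§2). [cite: SerreLocalFields1979, Ch. VII §5]
[cite: NeukirchSchmidtWingberg2008, I §6 (1.6.5)] [cite: SerreGaloisCohomology1997, I §2.5 Prop. 10] -/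
theorem coindOpenHRep_mk_layerToCoind (u : ↥(galoisGroupAbove S H))
    (c : letI := algOfLE (show E.1 ≤ E'.1 from hEE'); groupCohomology (sUnitsRep K S ↥E.1 ↥E'.1) 2) :
    (resRep K S H).coindOpenHRep (layerW hHo E hF hS) (isOpen_layerW hHo E hF hS) 2 (QuotientGroup.mk u) (layerToCoind hHo hEE' hF hS hS' c) =
      layerToCoind hHo hEE' hF hS hS'
        (letI := algOfLE hF
         letI := algOfLE (show E.1 ≤ E'.1 from hEE')
         letI := algOfLE (hF.trans (show E.1 ≤ E'.1 from hEE'))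
         haveI := isScalarTower_algOfLE₃ hF (show E.1 ≤ E'.1 from hEE')
         haveI := E.isGalois
         haveI := normal_algOfLE (K := K) hF
         sUnitsConj ↥(baseField H) ↥E.1 ↥E'.1 S
          (OpenSubgroupLayer.layerEquiv S hHo E' (hF.trans hEE') hS' (QuotientGroup.mk u)) 2 c) := by
  letI := algOfLE hF
  letI := algOfLE (show E.1 ≤ E'.1 from hEE')
  letI := algOfLE (hF.trans (show E.1 ≤ E'.1 from hEE'))
  haveI := isScalarTower_algOfLE₃ hF (show E.1 ≤ E'.1 from hEE')
  haveI := E.isGalois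
  haveI := normal_algOfLE (K := K) hF
  obtain ⟨y, hy⟩ := exists_relIso_shapiroFun_eq hHo hEE' hF hS hS' c
  have hconj := (resRep K S H).coindOpenHRep_layer_conj (layerW hHo E hF hS) (isOpen_layerW hHo E hF hS) (OpenSubgroupLayer.layerSubgroup S hHo E' (hF.trans hEE') hS') (layerSubgroup_le_of_le S hHo hEE' hF hS hS') (ContinuousRep.discreteTopology_coindOpen (layerW hHo E hF hS) (isOpen_layerW hHo E hF hS)) 2 u y
  rw [layerToCoind_eq_of_shapiroFun_eq hHo hEE' hF hS hS' c y hy]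
  refine hconj.1.trans ?_
  symm
  apply layerToCoind_eq_of_shapiroFun_eq hHo hEE' hF hS hS'
  rw [hconj.2, relIso_hom_conjRepCohomology, hy]

omit [CompactSpace ↥(galoisGroupAbove S H)] [CompactSpace ↥(layerW hHo E hF hS)] in
/-- A lift `u ∈ U` of `t ∈ Gal(E′/F₀)` lifts `d ∈ U ⧸ W` when `layerEquiv E d = t|_E` (`layerEquiv E` is injective and
`(layerEquiv E′ [u])|_E = layerEquiv E [u]`). [cite: NeukirchSchmidtWingberg2008, VIII §3, (1.5.1)] -/
theorem exists_mk_eq_layerEquiv_eq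
    (t : letI := algOfLE (hF.trans (show E.1 ≤ E'.1 from hEE')); ↥E'.1 ≃ₐ[↥(baseField H)] ↥E'.1)
    (d : ↥(galoisGroupAbove S H) ⧸ (layerW hHo E hF hS))
    (hd : letI := algOfLE hF
      letI := algOfLE (show E.1 ≤ E'.1 from hEE')
      letI := algOfLE (hF.trans (show E.1 ≤ E'.1 from hEE'))
      haveI := isScalarTower_algOfLE₃ hF (show E.1 ≤ E'.1 from hEE')
      haveI := E.isGalois
      haveI := normal_algOfLE (K := K) hF
      OpenSubgroupLayer.layerEquiv S hHo E hF hS d = t.restrictNormal ↥E.1) :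
    ∃ u : ↥(galoisGroupAbove S H), (QuotientGroup.mk u : ↥(galoisGroupAbove S H) ⧸ (layerW hHo E hF hS)) = d ∧
      (letI := algOfLE (hF.trans (show E.1 ≤ E'.1 from hEE'))
       OpenSubgroupLayer.layerEquiv S hHo E' (hF.trans hEE') hS' (QuotientGroup.mk u) = t) := by
  letI := algOfLE hF
  letI := algOfLE (show E.1 ≤ E'.1 from hEE')
  letI := algOfLE (hF.trans (show E.1 ≤ E'.1 from hEE'))
  haveI := isScalarTower_algOfLE₃ hF (show E.1 ≤ E'.1 from hEE')
  haveI := E.isGalois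
  haveI := normal_algOfLE (K := K) hF
  obtain ⟨q, hq⟩ := (OpenSubgroupLayer.layerEquiv S hHo E' (hF.trans hEE') hS').surjective t
  induction q using QuotientGroup.induction_on with
  | H u =>
    refine ⟨u, ?_, hq⟩
    apply (OpenSubgroupLayer.layerEquiv S hHo E hF hS).injective
    rw [hd]
    refine AlgEquiv.ext fun x => Subtype.ext ?_
    rw [coe_layerEquiv_mk_eq_of_le S hHo hEE' hF hS' u x, hq]
    exact (coe_restrictNormal_apply hF (show E.1 ≤ E'.1 from hEE') t x).symm

set_option maxRecDepth 8192 in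
/-- **(e) `R_d (layerToCoind E′ c) = layerToCoind E′ (σ_t c)` whenever `layerEquiv E d = t|_E`** (`d ∈ U ⧸ W`,
`t ∈ Gal(E′/F₀)`). [cite: SerreLocalFields1979, Ch. VII §5] [cite: NeukirchSchmidtWingberg2008, I §6 (1.6.5)] -/
theorem coindOpenHRep_layerToCoind
    (t : letI := algOfLE (hF.trans (show E.1 ≤ E'.1 from hEE')); ↥E'.1 ≃ₐ[↥(baseField H)] ↥E'.1)
    (d : ↥(galoisGroupAbove S H) ⧸ (layerW hHo E hF hS))
    (hd : letI := algOfLE hF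
      letI := algOfLE (show E.1 ≤ E'.1 from hEE')
      letI := algOfLE (hF.trans (show E.1 ≤ E'.1 from hEE'))
      haveI := isScalarTower_algOfLE₃ hF (show E.1 ≤ E'.1 from hEE')
      haveI := E.isGalois
      haveI := normal_algOfLE (K := K) hF
      OpenSubgroupLayer.layerEquiv S hHo E hF hS d = t.restrictNormal ↥E.1)
    (c : letI := algOfLE (show E.1 ≤ E'.1 from hEE'); groupCohomology (sUnitsRep K S ↥E.1 ↥E'.1) 2) :
    (resRep K S H).coindOpenHRep (layerW hHo E hF hS) (isOpen_layerW hHo E hF hS) 2 d (layerToCoind hHo hEE' hF hS hS' c) =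
      layerToCoind hHo hEE' hF hS hS'
        (letI := algOfLE hF
         letI := algOfLE (show E.1 ≤ E'.1 from hEE')
         letI := algOfLE (hF.trans (show E.1 ≤ E'.1 from hEE'))
         haveI := isScalarTower_algOfLE₃ hF (show E.1 ≤ E'.1 from hEE')
         haveI := E.isGalois
         haveI := normal_algOfLE (K := K) hF
         sUnitsConj ↥(baseField H) ↥E.1 ↥E'.1 S t 2 c) := by
  obtain ⟨u, rfl, rfl⟩ := exists_mk_eq_layerEquiv_eq hHo hEE' hF hS hS' t d hd
  exact coindOpenHRep_mk_layerToCoind hHo hEE' hF hS hS' u c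

end LayerW

/-! ### §6. The instance -/

set_option maxRecDepth 100000 in
/-- **THE LAYER PRESENTATION of `𝓗²(E_S)`** (-w3 g16's `LayerPresentation`, fields (a)–(e) from §4–§5): the last input of
FILE D's `hH2`. [cite: NeukirchSchmidtWingberg2008, VIII §3 (8.3.11), I §6 (1.6.4)–(1.6.5)] [cite: SerreGaloisCohomology1997, I §2.2 Prop. 8, §2.5 Prop. 10] -/
def layerPresentation (hNH : ramificationSubgroup K S ≤ H) : LayerPresentation hHo E hF hS :=
  haveI := compactSpace_layerW hHo hF hS
  { toCoind := fun _ hEE' hS' => layerToCoind hHo hEE' hF hS hS'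
    toCoind_layerInf := fun _ _ hEE' hE'E'' hS' hS'' c => layerToCoind_layerInf hHo hEE' hF hS hS' hE'E'' hS'' c
    exists_eq := fun y => exists_layerToCoind_eq hHo hF hS hNH y
    exists_layerInf_eq_zero := fun _ hEE' hS' c h0 =>
      exists_layerInf_eq_zero_of_layerToCoind_eq_zero hHo hEE' hF hS hS' hNH c h0
    coindOpenHRep_toCoind := fun _ hEE' hS' t d hd c => coindOpenHRep_layerToCoind hHo hEE' hF hS hS' t d hd c }

end Layers

end SUnits

end Literature.NumberTheory.GaloisRepresentations

end
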